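import Summits.AtomisticToContinuum.Crystallization.Theses.ChessboardParticlePlanes
import Summits.AtomisticToContinuum.Crystallization.Theorems.ChessboardParticlePlanesLjPlaneChessboardHeightSplit
import Summits.AtomisticToContinuum.Crystallization.Theorems.ChessboardParticlePlanesLjPlaneChessboardSiteSumQ
import Summits.AtomisticToContinuum.Crystallization.Theorems.ChessboardParticlePlanesLjPlaneChessboardSiteSumUp
import Summits.AtomisticToContinuum.Crystallization.Theorems.ChessboardParticlePlanesLjPlaneChessboardSiteSumDn

/-!
# Crux `ChessboardParticlePlanes.LjPlaneChessboard` (stmt-AtomisticToContinuum-6709), line `Sketch`,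
# stub `deficitSite_layerForm` — the per-site chessboard deficit in layer form

Let `Q` be a periodic configuration of `ℝ³` with two `ℝ`-independent horizontal periods, whose
occupied heights are enumerated by a strictly increasing `z : ℤ → ℝ` (every point has height some
`z i`, every `z i` is occupied), with `z (i + 1) = τu (z i)` and `τd (z (i + 1)) = z i`, and let
`x ∈ Q.points` lie on the plane `i₀` (`x 2 = z i₀`).  Write `S_Q(x)`, `S_up(x)`, `S_dn(x)` for the
Lennard-Jones site sums of `x` over `Q.points`, over the upward restack of the layers
`{x₂ = x 2}, {x₂ = τu (x 2)}` and over the downward restack of the layers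
`{x₂ = τd (x 2)}, {x₂ = x 2}`, and `c = z (i₀ + 1) - z i₀`, `c' = z i₀ - z (i₀ - 1)`.

CLAIM (the registered sub-goal).  The per-site chessboard deficit is the layer form

  `2 S_Q(x) - S_up(x) - S_dn(x)`
  `  = 2 Σ'_{m ≠ i₀} Σ'_{y₂ = z m} V(√(‖x - y‖² - (x 2 - z m)² + (z i₀ - z m)²))`
  `    - (Σ'_{k ≠ 0} Σ'_{y₂ = x 2} V(√(‖x - y‖² + (2|k|c)²))`
  `        + Σ'_k Σ'_{y₂ = z (i₀+1)} V(√(‖x - y‖² - (x 2 - z (i₀+1))² + (|2k+1|c)²)))`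
  `    - (Σ'_{k ≠ 0} Σ'_{y₂ = x 2} V(√(‖x - y‖² + (2|k|c')²))`
  `        + Σ'_k Σ'_{y₂ = z (i₀-1)} V(√(‖x - y‖² - (x 2 - z (i₀-1))² + (|2k+1|c')²)))`

(inner sums over the points `y ∈ Q.points` of the indicated height).

PROOF (assembly, [folklore]).  By `siteSum_layers_Q` (its height-splitting hypothesis discharged
by `siteSum_heightSplit`) `S_Q(x) = P + A` with `P` the in-plane sum `Σ'_{y₂ = x 2, y ≠ x} V(|x - y|)`
and `A` the displayed sum over `m ≠ i₀`.  Since `x 2 = z i₀`, `τu (x 2) = z (i₀ + 1) > x 2` and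
`τd (x 2) = z (i₀ - 1) < x 2` (strict monotonicity), both occupied; so `restackUp_core` at the
height `z (i₀ + 1)` gives `S_up(x) = P + B + C` and `restackDn_siteSum` at the height `z (i₀ - 1)`
gives `S_dn(x) = P + D + E`, with `B, C, D, E` the four displayed restack sums (offsets
`z (i₀ + 1) - x 2 = c`, `x 2 - z (i₀ - 1) = c'`).  Hence
`2 (P + A) - (P + B + C) - (P + D + E) = 2 A - (B + C) - (D + E)`: the in-plane sums cancel.

No definition and no notation is introduced.
-/

noncomputable section

namespace Summit.AtomisticToContinuum.Crystallization.Theorems.ChessboardParticlePlanesLjPlaneChessboard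

open Literature.MathematicalPhysics.StatisticalMechanics

/-- **Registered sub-goal `deficitSite_layerForm`: the per-site chessboard deficit in layer form.**
For a periodic configuration `Q` of `ℝ³` with two `ℝ`-independent horizontal periods, a strictly
increasing enumeration `z` of its occupied heights (all occupied) with `z (i + 1) = τu (z i)`,
`τd (z (i + 1)) = z i`, and a point `x ∈ Q.points` with `x 2 = z i₀`, the deficit
`2 S_Q(x) - S_up(x) - S_dn(x)` of the Lennard-Jones site sums over `Q.points` and over the
up/down restacks equals twice the cross-plane layer sums of `Q` minus the restacked layer sums at
the vertical offsets `2|k|c`, `|2k+1|c` (`c = z (i₀+1) - z i₀`) and `2|k|c'`, `|2k+1|c'`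
(`c' = z i₀ - z (i₀-1)`): the in-plane sums cancel (`siteSum_layers_Q`, `siteSum_heightSplit`,
`restackUp_core`, `restackDn_siteSum`). [folklore] -/
theorem deficitSite_layerForm :
    ∀ (Q : PeriodicConfiguration 3) (τu τd : ℝ → ℝ) (z : ℤ → ℝ) (i₀ : ℤ) (x : EuclideanSpace ℝ (Fin 3)),
      (∃ a ∈ Q.lattice, ∃ b ∈ Q.lattice, a 2 = 0 ∧ b 2 = 0 ∧ LinearIndependent ℝ ![a, b]) →
      (∀ x' ∈ Q.points, ∀ y ∈ Q.points, x' 2 ≠ y 2 → (3 : ℝ) / 4 ≤ |x' 2 - y 2|) →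
      StrictMono z → (∀ y ∈ Q.points, ∃ i : ℤ, y 2 = z i) → (∀ i : ℤ, ∃ y ∈ Q.points, y 2 = z i) →
      (∀ i : ℤ, z (i + 1) = τu (z i)) → (∀ i : ℤ, τd (z (i + 1)) = z i) →
      x ∈ Q.points → x 2 = z i₀ →
      2 * (∑' y : {y : EuclideanSpace ℝ (Fin 3) // y ∈ Q.points ∧ y ≠ x}, lennardJones (dist x y.1))
        - (∑' y : {y : EuclideanSpace ℝ (Fin 3) //
              y ∈ {p : EuclideanSpace ℝ (Fin 3) | ∃ k : ℤ, ∃ x' ∈ Q.points,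
                (x' 2 = x 2 ∨ x' 2 = τu (x 2)) ∧
                p = x' + ((2 * (τu (x 2) - x 2)) * (k : ℝ)) •
                  EuclideanSpace.single (2 : Fin 3) (1 : ℝ)} ∧ y ≠ x},
              lennardJones (dist x y.1))
        - (∑' y : {y : EuclideanSpace ℝ (Fin 3) //
              y ∈ {p : EuclideanSpace ℝ (Fin 3) | ∃ k : ℤ, ∃ x' ∈ Q.points,
                (x' 2 = τd (x 2) ∨ x' 2 = x 2) ∧
                p = x' + ((2 * (x 2 - τd (x 2))) * (k : ℝ)) •
                  EuclideanSpace.single (2 : Fin 3) (1 : ℝ)} ∧ y ≠ x},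
              lennardJones (dist x y.1)) =
      2 * (∑' m : {m : ℤ // m ≠ i₀},
            ∑' y : {y : EuclideanSpace ℝ (Fin 3) // y ∈ Q.points ∧ y 2 = z m},
              lennardJones (Real.sqrt (‖x - y.1‖ ^ 2 - (x 2 - z m) ^ 2 + (z i₀ - z m) ^ 2)))
        - ((∑' k : {k : ℤ // k ≠ 0},
              ∑' y : {y : EuclideanSpace ℝ (Fin 3) // y ∈ Q.points ∧ y 2 = x 2},
                lennardJones (Real.sqrt (‖x - y.1‖ ^ 2
                  + (2 * |(k : ℝ)| * (z (i₀ + 1) - z i₀)) ^ 2))) +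
            ∑' k : ℤ,
              ∑' y : {y : EuclideanSpace ℝ (Fin 3) // y ∈ Q.points ∧ y 2 = z (i₀ + 1)},
                lennardJones (Real.sqrt (‖x - y.1‖ ^ 2 - (x 2 - z (i₀ + 1)) ^ 2
                  + (|2 * (k : ℝ) + 1| * (z (i₀ + 1) - z i₀)) ^ 2)))
        - ((∑' k : {k : ℤ // k ≠ 0},
              ∑' y : {y : EuclideanSpace ℝ (Fin 3) // y ∈ Q.points ∧ y 2 = x 2},
                lennardJones (Real.sqrt (‖x - y.1‖ ^ 2
                  + (2 * |(k : ℝ)| * (z i₀ - z (i₀ - 1))) ^ 2))) +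
            ∑' k : ℤ,
              ∑' y : {y : EuclideanSpace ℝ (Fin 3) // y ∈ Q.points ∧ y 2 = z (i₀ - 1)},
                lennardJones (Real.sqrt (‖x - y.1‖ ^ 2 - (x 2 - z (i₀ - 1)) ^ 2
                  + (|2 * (k : ℝ) + 1| * (z i₀ - z (i₀ - 1))) ^ 2))) := by
  intro Q τu τd z i₀ x hab _hsep hz hcov hocc hτu hτd hx hxz
  -- the neighbouring occupied heights of `x`
  have hup : τu (x 2) = z (i₀ + 1) := by rw [hxz, hτu]
  have hdn : τd (x 2) = z (i₀ - 1) := by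
    have h := hτd (i₀ - 1)
    rwa [sub_add_cancel, ← hxz] at h
  have hlt_up : x 2 < z (i₀ + 1) := by
    rw [hxz]
    exact hz (lt_add_one i₀)
  have hlt_dn : z (i₀ - 1) < x 2 := by
    rw [hxz]
    exact hz (sub_one_lt i₀)
  -- the three site sums in layer form
  have hQ := (siteSum_layers_Q siteSum_heightSplit Q z i₀ x hz hcov hx hxz).2
  have hU := (restackUp_core Q x (z (i₀ + 1)) hab hx hlt_up (hocc (i₀ + 1))).2.2
  have hD := (restackDn_siteSum Q x (z (i₀ - 1)) hab hx hlt_dn (hocc (i₀ - 1))).2.2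
  -- the vertical offsets `c = z (i₀ + 1) - x 2`, `c' = x 2 - z (i₀ - 1)` in terms of `z`
  have e1 : z (i₀ + 1) - x 2 = z (i₀ + 1) - z i₀ := by rw [hxz]
  have e2 : x 2 - z (i₀ - 1) = z i₀ - z (i₀ - 1) := by rw [hxz]
  rw [hup, hdn, hQ, hU, hD, e1, e2]
  ring

end Summit.AtomisticToContinuum.Crystallization.Theorems.ChessboardParticlePlanesLjPlaneChessboard

end
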